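import Mathlib
import Summits.RiemannHypothesis.RiemannHypothesis.Theorems.WeilFormatCCellShiftCertA09p4
import Summits.RiemannHypothesis.RiemannHypothesis.Theorems.WeilFormatCCellShiftCertA09p4T
import Summits.RiemannHypothesis.RiemannHypothesis.Theorems.WeilFormatCCellShiftCertRange
import HarnessLib

/-!
# Kernel class parts of the cell-refined shift certificate `cellA09p4`: row-range parts 2, 3, 4, 5

Helper file (`--supports stmt-RiemannHypothesis-0098`), RH-free; seat rh-explicit-weil-1 gen4; re-split into ≤ 35-s files by gen5 (lead R9-34 (C)).  One `decide +kernel` pair pass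
per class part of `CellSOS.cellA09p4` (`WeilFormatCCellShiftCertA09p4.lean`); consumed by the bound file together with `cellA09p4_check`.
-/

set_option linter.dupNamespace false

namespace Summit.RiemannHypothesis.RiemannHypothesis.Theorems.WeilFormatC.CellSOS

set_option maxHeartbeats 0 in
set_option maxRecDepth 100000 in
/-- Row-range part 2 of `cellA09p4`: the kernel's partial class table IS the claimed one. [folklore] -/
theorem cellA09p4_tabR2 : cellA09p4.checkTab cellA09p4T 2 = true := by
  decide +kernel

set_option maxHeartbeats 0 in
set_option maxRecDepth 100000 in
/-- Row-range part 3 of `cellA09p4`: the kernel's partial class table IS the claimed one. [folklore] -/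
theorem cellA09p4_tabR3 : cellA09p4.checkTab cellA09p4T 3 = true := by
  decide +kernel

set_option maxHeartbeats 0 in
set_option maxRecDepth 100000 in
/-- Row-range part 4 of `cellA09p4`: the kernel's partial class table IS the claimed one. [folklore] -/
theorem cellA09p4_tabR4 : cellA09p4.checkTab cellA09p4T 4 = true := by
  decide +kernel

set_option maxHeartbeats 0 in
set_option maxRecDepth 100000 in
/-- Row-range part 5 of `cellA09p4`: the kernel's partial class table IS the claimed one. [folklore] -/
theorem cellA09p4_tabR5 : cellA09p4.checkTab cellA09p4T 5 = true := by
  decide +kernel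

end Summit.RiemannHypothesis.RiemannHypothesis.Theorems.WeilFormatC.CellSOS
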